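import Summits.QuantumFields.YangMills.Theses.MirrorModularBoosts
import Literature.MathematicalPhysics.AQFT.StandardSubspace

/-!
# Sketch — crux-ideate stmt-QuantumFields-9663 (CurvatureBoostCovariance), round 1, ideator 2

First-lemma signatures for the two idea cards
* `anisotropy-costs-a-dimension`  (namespace `…AnisotropyCostsADimension`)
* `one-field-cocycle-pinning`     (namespace `…OneFieldCocyclePinning`)
Stubs are `sorry`; the `def … : Prop` items are statement targets (they must only elaborate).
-/

open scoped BigOperators Topology InnerProductSpace ComplexConjugate
open Filter Set

namespace Summit.QuantumFields.YangMills.Cruxes.CurvatureBoostCovariance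

open Literature.MathematicalPhysics.QuantumLattice Literature.MathematicalPhysics.AQFT
  Literature.MathematicalPhysics.QuantumFieldTheory

/-! ## Card 1: anisotropy costs a dimension -/
namespace AnisotropyCostsADimension

/-- The rapidity PINCER in one line: on a fibre the D₈-admissible weight is `P(cosh 4χ)`; positivity on
the axis lines (`P(y) ≥ 0`, `y ≥ 1`) and on the diagonal lines (`P(-y) ≥ 0`, `y ≥ 1`) kills the
degree-one anisotropy `a + b·cosh 4χ`.  (First checkable lemma; elementary.) -/
theorem coshFour_pincer (a b : ℝ) (h : ∀ y : ℝ, 1 ≤ y → 0 ≤ a + b * y ∧ 0 ≤ a - b * y) : b = 0 := by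
  sorry

/-- **UV scaling degree `< 10` of the two-point function** of a one-species Schwinger family on `ℝ⁴`,
tested on dilated disjoint real tensors `f(·/λ) ⊗ g(·/λ)`:  `|𝔖₂(f_λ ⊗ g_λ)| ≤ C λ^{η-2}` for
`λ ∈ (0,1]` (for a kernel `~|x|^{-γ}` the left side is `~λ^{8-γ}`, so this says `γ ≤ 10 - η`).
Expected for `tr F²`: `γ = 8` (+ logs). -/
def HasTwoPointUVDegreeLtTen (S : SchwingerFamily (EuclideanSpace ℝ (Fin 4))) : Prop :=
  ∃ η : ℝ, 0 < η ∧
    ∀ (f g : SchwartzMap (EuclideanSpace ℝ (Fin 4)) ℝ)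
      (F : SchwartzMap (Fin 2 → EuclideanSpace ℝ (Fin 4)) ℂ),
      IsTensorOf F ![ofRealTest f, ofRealTest g] → IsOffDiagonal F →
      ∃ C : ℝ, ∀ (lam : ℝ) (hlam : 0 < lam), lam ≤ 1 →
        ∀ Fl : SchwartzMap (Fin 2 → EuclideanSpace ℝ (Fin 4)) ℂ,
          IsTensorOf Fl ![ofRealTest (dilateTest lam hlam.ne' f), ofRealTest (dilateTest lam hlam.ne' g)] →
          ‖S 2 Fl‖ ≤ C * lam ^ (η - 2)

/-- **(AD₂) Planar "anisotropy costs a dimension", two-point, model-blind.**  A one-species family on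
`ℝ⁴` with E0' and E3, translation invariant and invariant under the proper signed permutations on
⁰𝒮, reflection positive in pull-back form in the EIGHT planar frames (time axis `a e₀ + b e₁`,
`a²+b²=1`, `a=0 ∨ b=0 ∨ a²=b²`), whose two-point function has UV degree `< 10`, has an
`SO(2)₀₁`-invariant TWO-POINT function on ⁰𝒮 (every det-1 isometry fixing `e₂, e₃`). -/
def PlanarAnisotropyCostsDimension : Prop :=
  let E := EuclideanSpace ℝ (Fin 4)
  ∀ (S : SchwingerFamily E), S.toLabelled.HasLinearGrowth → S.toLabelled.IsSymmetric →
    (∀ (n : ℕ) (a : E) (F : SchwartzMap (Fin n → E) ℂ), IsOffDiagonal F →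
      S n (translateMulti a F) = S n F) →
    (∀ (R : E ≃ₗᵢ[ℝ] E), LinearMap.det (R.toLinearEquiv : E →ₗ[ℝ] E) = 1 →
      (∀ i : Fin 4, ∃ j : Fin 4, R (EuclideanSpace.single i 1) = EuclideanSpace.single j 1 ∨
        R (EuclideanSpace.single i 1) = -EuclideanSpace.single j 1) →
      ∀ (n : ℕ) (F : SchwartzMap (Fin n → E) ℂ), IsOffDiagonal F → S n (linActMulti R F) = S n F) →
    (∀ (R : E ≃ₗᵢ[ℝ] E) (a b : ℝ), a ^ 2 + b ^ 2 = 1 → (a = 0 ∨ b = 0 ∨ a ^ 2 = b ^ 2) →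
      R (EuclideanSpace.single 0 1) = a • EuclideanSpace.single 0 1 + b • EuclideanSpace.single 1 1 →
      (SchwingerFamily.toLabelled (fun n => (S n).comp (linActMulti R))).IsReflectionPositive) →
    HasTwoPointUVDegreeLtTen S →
    ∀ (R : E ≃ₗᵢ[ℝ] E), LinearMap.det (R.toLinearEquiv : E →ₗ[ℝ] E) = 1 →
      R (EuclideanSpace.single 2 1) = EuclideanSpace.single 2 1 →
      R (EuclideanSpace.single 3 1) = EuclideanSpace.single 3 1 →
      ∀ (F : SchwartzMap (Fin 2 → E) ℂ), IsOffDiagonal F → S 2 (linActMulti R F) = S 2 F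

/-- **(YM input) UV degree of the curvature channel.**  For every compact simple `G`, every `(r, sch, S₁)`
carrying the curvature-channel package `W₁` of the route (verbatim the hypothesis of
`CurvatureBoostCovariance`), the two-point function of `S₁` has UV scaling degree `< 10`
(asymptotic freedom predicts `8`; the card needs only `< 10`, i.e. "dimension of `tr F²` is `< 5`"). -/
def CurvatureUVDegree : Prop :=
  let E := EuclideanSpace ℝ (Fin 4)
  ∀ (G : Type) [Group G] [TopologicalSpace G] [IsTopologicalGroup G] [CompactSpace G],
    IsCompactSimpleLieGroup G →
    letI : MeasurableSpace G := borel G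
    haveI : BorelSpace G := ⟨rfl⟩
    let W₁ := fun (r : LatticeRep G) (sch : SpeciesScheme (YMSpecies G)) (S₁ : SchwingerFamily E) =>
      ((∀ (n : ℕ), n ≠ 0 → ∀ (f : Fin n → SchwartzMap (E) ℝ) (F : SchwartzMap (Fin n → E) ℂ),
          IsTensorOf F (fun i => ofRealTest (f i)) → IsOffDiagonal F →
          Filter.Tendsto (fun k : ℕ => ((latticeSchwinger r.ρ sch (fun s => s.F) k n
            (fun _ => r.curvature) f : ℝ) : ℂ)) Filter.atTop (nhds (S₁ n F))) ∧
        (S₁.toLabelled.IsNormalized ∧ S₁.toLabelled.IsHermitian ∧ S₁.toLabelled.HasLinearGrowth ∧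
          S₁.toLabelled.IsReflectionPositive ∧ S₁.toLabelled.IsSymmetric ∧
          S₁.toLabelled.HasClusterProperty) ∧
        (∀ (n : ℕ) (a : E) (F : SchwartzMap (Fin n → E) ℂ), IsOffDiagonal F →
          S₁ n (translateMulti a F) = S₁ n F) ∧
        (∀ (R : E ≃ₗᵢ[ℝ] E), LinearMap.det (R.toLinearEquiv : E →ₗ[ℝ] E) = 1 →
          (∀ i : Fin 4, ∃ j : Fin 4, R (EuclideanSpace.single i 1) = EuclideanSpace.single j 1 ∨
            R (EuclideanSpace.single i 1) = -EuclideanSpace.single j 1) →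
          ∀ (n : ℕ) (F : SchwartzMap (Fin n → E) ℂ), IsOffDiagonal F →
            S₁ n (linActMulti R F) = S₁ n F) ∧
        (∃ Δ : ℝ, 0 < Δ ∧ S₁.toLabelled.HasMassGap Δ ∧ HasLatticeMassGap r sch Δ))
    ∀ (r : LatticeRep G) (sch : SpeciesScheme (YMSpecies G)) (S₁ : SchwingerFamily E),
      W₁ r sch S₁ → HasTwoPointUVDegreeLtTen S₁

end AnisotropyCostsADimension

/-! ## Card 2: one-field cocycle pinning -/
namespace OneFieldCocyclePinning

/-- **Periodic zero-free rigidity** (the complex-analysis core of "a Borchers cocycle pinned at the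
quarter-turn is trivial"): an entire zero-free function, `iπ/2`-periodic, of exponential type in
`Re z`, is `c·e^{4kz}` with `k ∈ ℤ`.  (Proof: `h = e^g`, Borel–Carathéodory makes `g` affine,
periodicity quantises the slope.) -/
theorem periodic_zeroFree_rigidity (h : ℂ → ℂ) (hd : Differentiable ℂ h) (h0 : ∀ z, h z ≠ 0)
    (hper : ∀ z : ℂ, h (z + ((Real.pi / 2 : ℝ) : ℂ) * Complex.I) = h z)
    (hgrowth : ∃ C N : ℝ, ∀ z : ℂ, ‖h z‖ ≤ C * Real.exp (N * |z.re|)) :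
    ∃ (c : ℂ) (k : ℤ), ∀ z : ℂ, h z = c * Complex.exp (4 * (k : ℂ) * z) := by
  sorry

/-- **Compression square-root rigidity** (bounded model of the equality case in the operator Jensen
inequality used to pass from the one-field standard subspace to the wedge): if the quadratic forms of
`√A` and of `√(PAP)` agree on `ran P`, then `P` reduces `A`. -/
def CompressionSqrtRigidity : Prop :=
  ∀ (H : Type) [NormedAddCommGroup H] [InnerProductSpace ℂ H] [CompleteSpace H]
    (A P : H →L[ℂ] H), A.IsPositive → IsSelfAdjoint P → P * P = P →
    (∀ x : H, P x = x →
      ⟪x, (cfc Real.sqrt A) x⟫_ℂ = ⟪x, (cfc Real.sqrt (P * A * P)) x⟫_ℂ) →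
    P * A = A * P

/-- **One-particle KMS uniqueness, covariant form** (the tree's `subsingleton_modularData` is the engine):
a strongly continuous unitary group `W` that leaves a standard subspace `V` invariant and satisfies the
one-particle KMS condition at inverse temperature `1` on `V` coincides with `t ↦ Δ_V^{-it}` — used with
`W` = the geometric planar boosts on the closed span of one-field curvature vectors once the two-point
function is rotation invariant (card 1). -/
def CovariantKMSUniqueness : Prop :=
  ∀ (H : Type) [NormedAddCommGroup H] [InnerProductSpace ℂ H] [CompleteSpace H]
    (V : StandardSubspace H) (D : StandardSubspace.ModularData V)
    (W : Literature.Analysis.UnboundedOperators.OneParameterUnitaryGroup H),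
    (∀ (t : ℝ), ∀ x ∈ V.toClosedSubmodule, W.appReal t x ∈ V.toClosedSubmodule) →
    (∀ ξ ∈ V.toClosedSubmodule, ∀ η ∈ V.toClosedSubmodule, ∃ F : ℂ → ℂ,
      ContinuousOn F (StandardSubspace.closedStrip 1) ∧
      DifferentiableOn ℂ F (StandardSubspace.openStrip 1) ∧
      (∃ C : ℝ, ∀ z ∈ StandardSubspace.closedStrip 1, ‖F z‖ ≤ C) ∧
      (∀ t : ℝ, F t = ⟪η, W.appReal (-t) ξ⟫_ℂ) ∧ (∀ t : ℝ, F (t + Complex.I) = ⟪W.appReal (-t) ξ, η⟫_ℂ)) →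
    ∀ t : ℝ, W.appReal t = D.U.appReal t

end OneFieldCocyclePinning

end Summit.QuantumFields.YangMills.Cruxes.CurvatureBoostCovariance
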